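import Summits.Ventures.HodgeRepro2.T5SU11KernelCompositionStrictSign

/-!
# The composed kernels are STRICTLY monotone in the spectral parameter

With the strict sign `(−1)^{n+2} K^{∘(n+2)} > 0` (row 594) the derivatives `∂_μ K_μ^{∘(n+1)} = (n + 1) K_μ^{∘(n+2)}` (row 580)
and `∂_λ K_λ^{∘(n+1)} = (2λ − 2)(n + 1) K_λ^{∘(n+2)}` (row 579) of the signed composed kernels are strictly positive:

* `kernel_comp_sign_strictMonoOn_mu`, `kernel_comp_sign_strictMonoOn_lam` — **`(−1)ⁿ K^{∘(n+1)}(t, s)` is strictly increasing in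
  `μ` on `(−1, ∞)` and in `λ` on `(1, ∞)`**;
* `kernel_strictMonoOn_mu`, `kernel_strictMonoOn_lam`, `kernel_lt_kernel_of_lt` — **the kernel `K_λ(t, s) < 0` itself is strictly
  increasing: `λ₂ < λ ⇒ K_{λ₂}(t, s) < K_λ(t, s) < 0`**.

Nothing is claimed about (N).

Blind lane: Mathlib + the HodgeRepro2 prefix only; no sorry; axioms ⊆ {propext, Classical.choice,
Quot.sound}.
-/

namespace Summit.Ventures.HodgeRepro2.T5SU11KernelCompositionStrictMono

open Filter Topology MeasureTheory
open Set (Ioi Ioc)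
open T5SU11Cartan T5SU11SphericalFunction T5SU11SphericalDecay T5SU11RadialGreenKernel T5SU11RadialGreenImproper
  T5SU11RadialGreenPositivity T5SU11KernelCompositionDerivative T5SU11KernelIteratedDerivative
  T5SU11ResolventDerivativeMu T5SU11KernelCompositionStrictSign

section measure

variable [MeasurableSpace Circle] [BorelSpace Circle]

variable {s : ℝ} (hs : 0 < s)

include hs in
/-- **`(−1)ⁿ K_μ^{∘(n+1)}(t, s)` is strictly increasing in `μ` on `(−1, ∞)`**: its derivative `(−1)ⁿ (n + 1) K_μ^{∘(n+2)}(t, s)` is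
`> 0` (row 580 and the strict sign of `K^{∘(n+2)}`). -/
theorem kernel_comp_sign_strictMonoOn_mu (n : ℕ) {t : ℝ} (ht : 0 < t) :
    StrictMonoOn (fun μ => (-1 : ℝ) ^ n * ((greenSolI (fun t => sph (1 + Real.sqrt (μ + 1)) (hyp t))
      (sphDecay (1 + Real.sqrt (μ + 1))))^[n] (fun r => sphGreenKernel (1 + Real.sqrt (μ + 1)) r s)) t) (Ioi (-1)) := by
  refine strictMonoOn_of_deriv_pos (convex_Ioi (-1 : ℝ)) ?_ ?_
  · intro μ hμ
    exact ((hasDerivAt_kernel_comp_mu hs n hμ ht).const_mul _).continuousAt.continuousWithinAt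
  · rw [interior_Ioi]
    intro μ hμ
    rw [((hasDerivAt_kernel_comp_mu hs n hμ ht).const_mul ((-1 : ℝ) ^ n)).deriv]
    have h := kernel_comp_sign_pos (one_lt_one_add_sqrt hμ) hs (n + 1) ht
    have e : (-1 : ℝ) ^ (n + 1 + 1) = (-1) ^ n := by
      rw [pow_succ, pow_succ]
      ring
    rw [e] at h
    have hn : (0 : ℝ) < (n + 1 : ℕ) := Nat.cast_pos.mpr (Nat.succ_pos n)
    calc (0 : ℝ) < ((n + 1 : ℕ) : ℝ) * ((-1 : ℝ) ^ n * ((greenSolI (fun t => sph (1 + Real.sqrt (μ + 1)) (hyp t))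
          (sphDecay (1 + Real.sqrt (μ + 1))))^[n + 1] (fun r => sphGreenKernel (1 + Real.sqrt (μ + 1)) r s)) t) :=
          mul_pos hn h
      _ = (-1 : ℝ) ^ n * ((n + 1 : ℕ) * ((greenSolI (fun t => sph (1 + Real.sqrt (μ + 1)) (hyp t))
          (sphDecay (1 + Real.sqrt (μ + 1))))^[n + 1] (fun r => sphGreenKernel (1 + Real.sqrt (μ + 1)) r s)) t) := by
          ring

include hs in
/-- **`(−1)ⁿ K_λ^{∘(n+1)}(t, s)` is strictly increasing in `λ` on `(1, ∞)`**. -/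
theorem kernel_comp_sign_strictMonoOn_lam (n : ℕ) {t : ℝ} (ht : 0 < t) :
    StrictMonoOn (fun lam => (-1 : ℝ) ^ n * ((greenSolI (fun t => sph lam (hyp t)) (sphDecay lam))^[n]
      (fun r => sphGreenKernel lam r s)) t) (Ioi 1) := by
  refine strictMonoOn_of_deriv_pos (convex_Ioi (1 : ℝ)) ?_ ?_
  · intro lam hlam
    exact ((hasDerivAt_kernel_comp_lam hlam hs n ht).const_mul _).continuousAt.continuousWithinAt
  · rw [interior_Ioi]
    intro lam hlam
    have hlam' : (1 : ℝ) < lam := hlam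
    rw [((hasDerivAt_kernel_comp_lam hlam' hs n ht).const_mul ((-1 : ℝ) ^ n)).deriv]
    have h := kernel_comp_sign_pos hlam' hs (n + 1) ht
    have e : (-1 : ℝ) ^ (n + 1 + 1) = (-1) ^ n := by
      rw [pow_succ, pow_succ]
      ring
    rw [e] at h
    have hn : (0 : ℝ) < (n + 1 : ℕ) := Nat.cast_pos.mpr (Nat.succ_pos n)
    have h2 : (0 : ℝ) < 2 * lam - 2 := by linarith
    calc (0 : ℝ) < (2 * lam - 2) * ((n + 1 : ℕ) : ℝ) * ((-1 : ℝ) ^ n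
          * ((greenSolI (fun t => sph lam (hyp t)) (sphDecay lam))^[n + 1] (fun r => sphGreenKernel lam r s)) t) :=
          mul_pos (mul_pos h2 hn) h
      _ = (-1 : ℝ) ^ n * ((2 * lam - 2) * ((n + 1 : ℕ) * ((greenSolI (fun t => sph lam (hyp t))
          (sphDecay lam))^[n + 1] (fun r => sphGreenKernel lam r s)) t)) := by
          ring

include hs in
/-- **The kernel is strictly increasing in `μ`** on `(−1, ∞)`. -/
theorem kernel_strictMonoOn_mu {t : ℝ} (ht : 0 < t) :
    StrictMonoOn (fun μ => sphGreenKernel (1 + Real.sqrt (μ + 1)) t s) (Ioi (-1)) := by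
  have h := kernel_comp_sign_strictMonoOn_mu hs 0 ht
  simpa only [pow_zero, one_mul, Function.iterate_zero, id_eq] using h

include hs in
/-- **The kernel is strictly increasing in `λ`** on `(1, ∞)`. -/
theorem kernel_strictMonoOn_lam {t : ℝ} (ht : 0 < t) :
    StrictMonoOn (fun lam => sphGreenKernel lam t s) (Ioi 1) := by
  have h := kernel_comp_sign_strictMonoOn_lam hs 0 ht
  simpa only [pow_zero, one_mul, Function.iterate_zero, id_eq] using h

include hs in
/-- **`λ₂ < λ ⇒ K_{λ₂}(t, s) < K_λ(t, s) < 0`** for `1 < λ₂`, `t, s > 0`. -/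
theorem kernel_lt_kernel_of_lt {lam lam₂ : ℝ} (hlam₂ : 1 < lam₂) (hlt : lam₂ < lam) {t : ℝ} (ht : 0 < t) :
    sphGreenKernel lam₂ t s < sphGreenKernel lam t s ∧ sphGreenKernel lam t s < 0 :=
  ⟨kernel_strictMonoOn_lam hs ht hlam₂ (show lam ∈ Ioi (1 : ℝ) from lt_trans hlam₂ hlt) hlt,
    sphGreenKernel_neg (lt_trans hlam₂ hlt) (s := s) ht⟩

end measure

end Summit.Ventures.HodgeRepro2.T5SU11KernelCompositionStrictMono
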